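import Literature.NumberTheory.EllipticCurves.ModularSymbolRepProofs
import Summits.KontsevichZagierPeriods.KontsevichZagierPeriods.Theorems.HeckeMultiplicityOneManinStokesValue

/-!
# `ManinStokes` (stmt-KontsevichZagierPeriods-5277, route `HeckeMultiplicityOne`): reduction of Manin's
# three-term relation INSIDE the KZ calculus to Cauchy's theorem on the six tiles of the ideal triangle

Support file (prover-owned, `--supports stmt-KontsevichZagierPeriods-5277`). Vocabulary: the modular-symbol
representations of `Literature/NumberTheory/EllipticCurves/ModularSymbolRep.lean` — for a weight-two cusp
form `f` on `Γ₀(N)` and `g ∈ SL₂(ℤ)` the class `ρ.classRe = [re h(f ∣ g)] − [re h(f ∣ gS)] ∈ KZ.FormalRep`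
of `re ⟨g⟩_f`, `⟨g⟩_f = 2πi ∫_{g0}^{g∞} f dz`, both half-arcs written over the domain
`arcDomain = (1728, ∞)` of the algebraic coordinate `u = j` with integrand `re (ω/dj) = re arcIntegrand`.

THE TYPED THREE-TERM RELATION (what the informal item `ManinStokes` says, in this vocabulary): with
`R = TS`, `ρ₀.classRe + ρ₁.classRe + ρ₂.classRe ∈ KZ.relations` for `ρ₀ : ModularSymbolRep f g`,
`ρ₁ : ModularSymbolRep f (gR)`, `ρ₂ : ModularSymbolRep f (gR²)` (arcs `{g0,g∞} + {g∞,g1} + {g1,g0}`,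
the boundary of the ideal triangle `Δ_g = g·(0, ∞, 1)`), and the same for `classIm`.

MECHANISM ("Manin's relations are zero-bulk Stokes"), made precise here. The barycentric subdivision of
`Δ = (0, ∞, 1)` consists of SIX `(2,3,∞)`-tiles: `P_k = R^k τ₀` and `M_k = R^k S τ₀*`, `k = 0,1,2`, where
`τ₀ = {0 < re z < 1/2, |z| > 1}` (edges `A = {it | t > 1}`, `B = {e^{iθ} | π/3 < θ < π/2}`,
`C = {1/2 + it | t > √3/2}`) and `τ₀* = {−1/2 < re z < 0, |z| > 1}` is its mirror image (edges `A`,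
`B* = SB`, `C* = T⁻¹C`). On every edge `j` is real: `j(A) = (1728, ∞)`, `j(B) = (0, 1728)`,
`j(C) = (−∞, 0)`. The six `A`-edges are the six half-arcs of `∂Δ_g`:
`classRe(gR^k) = [A(P_k)] − [A(M_k)]`; the `B`-edge of `P_k` is the `B*`-edge of `M_k` and the
`C`-edge of `P_k` is the `C*`-edge of `M_{k+1}` (indices mod 3; `RST⁻¹ = −1`, `R² = ST⁻¹`), with THE
SAME integrand in the coordinate `u` (`djQuot_SL_slash`: `(ω/dj)(f ∣ h)(τ) = (ω/dj)(f)(h τ)`). Hence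

  `Σ_k classRe(gR^k) ≡ Σ_k Cauchy(P_k) − Σ_k Cauchy(M_k)`  modulo `KZ.relations`,

where `Cauchy(tile)` is the formal sum `[A] + [B] + [C]` of the three edge representations of the tile
(all parametrised by increasing `u`; value `∮_{∂ tile} ω_f = 0`). This file PROVES that reduction
(`classRe_three_term_of_tiles`, `classIm_three_term_of_tiles`, from the part-generic
`three_term_of_tiles`): given, for each of the six tiles, edge representations over
`(1728, ∞)`, `(0, 1728)`, `(−∞, 0)` with the tile's integrands whose formal sum lies in `KZ.relations`
(hypotheses `hP₀ … hM₂`, the per-tile CAUCHY RELATIONS — the analytic content of the item, to be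
supplied by Green's formula inside the calculus in the coordinate `u`), the three-term relation holds.
The edge parametrisations `ζB, ζC : ℝ → ℍ` of `B`, `C` by `u = j` enter only formally (for the true
inverse branches of `j` the parametrisations of `B* = SB`, `C* = T⁻¹C` are `S ∘ ζB`, `T⁻¹ ∘ ζC`).

References: Ju. I. Manin, *Parabolic points and zeta functions of modular curves* (1972), §1.5–1.6;
J. E. Cremona, *Algorithms for modular elliptic curves* (1997), §2.1 (2.1.5); M. Kontsevich, D. Zagier,
*Periods* (2001), §1.2 and §3.4. No definitions, no named facts; everything here is proved.
-/

noncomputable section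

open scoped MatrixGroups ModularForm
open CongruenceSubgroup Complex MeasureTheory Set
open UpperHalfPlane hiding I
open Literature.NumberTheory.EllipticCurves.ModularForms
open Literature.NumberTheory.Transcendental Literature.NumberTheory.Transcendental.KZ

namespace Summit.KontsevichZagierPeriods.HeckeMultiplicityOne.ManinStokes

variable {N : ℕ}

/-! ### Pure bookkeeping: six tiles, three matched pairs of interior edges -/

/-- **The six-tile combination.** In an additive group with a subgroup `R` of relations: if the three
`P`-tiles and the three `M`-tiles have boundary sums in `R` (`a + b + c`), the `B`-edges of `P_k` and
`M_k` agree modulo `R` and the `C`-edge of `P_k` agrees with that of `M_{k+1}` modulo `R`, then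
`Σ_k (a_k − a'_k) ∈ R`. [folklore] -/
theorem six_tile_combination {G : Type*} [AddCommGroup G] (R : AddSubgroup G)
    {a₀ a₁ a₂ a₀' a₁' a₂' b₀ b₁ b₂ b₀' b₁' b₂' c₀ c₁ c₂ c₀' c₁' c₂' : G}
    (hP₀ : a₀ + b₀ + c₀ ∈ R) (hP₁ : a₁ + b₁ + c₁ ∈ R) (hP₂ : a₂ + b₂ + c₂ ∈ R)
    (hM₀ : a₀' + b₀' + c₀' ∈ R) (hM₁ : a₁' + b₁' + c₁' ∈ R) (hM₂ : a₂' + b₂' + c₂' ∈ R)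
    (hB₀ : b₀ - b₀' ∈ R) (hB₁ : b₁ - b₁' ∈ R) (hB₂ : b₂ - b₂' ∈ R)
    (hC₀ : c₀ - c₁' ∈ R) (hC₁ : c₁ - c₂' ∈ R) (hC₂ : c₂ - c₀' ∈ R) :
    (a₀ - a₀') + (a₁ - a₁') + (a₂ - a₂') ∈ R := by
  have h := R.sub_mem (R.sub_mem (R.add_mem (R.add_mem hP₀ hP₁) hP₂)
    (R.add_mem (R.add_mem hM₀ hM₁) hM₂))
    (R.add_mem (R.add_mem (R.add_mem hB₀ hB₁) hB₂) (R.add_mem (R.add_mem hC₀ hC₁) hC₂))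
  convert h using 1
  abel

/-- Two representations over the same domain whose integrands agree there with two functions that
agree pointwise on the domain differ by a relation (integrand additivity,
`equivalent_of_eqOn`). [cite: KontsevichZagierPeriods2001, §1.2 rule (1)] -/
theorem of_sub_of_mem_relations_of_eqOn_eqOn {n : ℕ} {D : Set (Fin n → ℝ)} {b b' : IntegralRep n}
    {F F' : (Fin n → ℝ) → ℝ} (hb : b.domain = D) (hbi : EqOn b.integrand F D)
    (hb' : b'.domain = D) (hb'i : EqOn b'.integrand F' D) (hFF' : ∀ x ∈ D, F x = F' x) :
    KZ.of b - KZ.of b' ∈ KZ.relations := by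
  refine equivalent_of_eqOn b b' (hb'.trans hb.symm) fun x hx => ?_
  have hx' : x ∈ D := hb ▸ hx
  rw [hbi hx', hb'i hx', hFF' x hx']

/-! ### The group identities pairing the interior edges -/

/-- `S² = −1` acts trivially: `(hS)·(S·ζ) = h·ζ`. [folklore] -/
theorem mul_S_smul_S_smul (h : SL(2, ℤ)) (ζ : ℍ) :
    (h * ModularGroup.S) • ModularGroup.S • ζ = h • ζ := by
  rw [← mul_smul, mul_assoc, S_mul_S, mul_neg_one, ModularGroup.SL_neg_smul]

/-- `TS·S·T⁻¹ = −1`. [folklore] -/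
theorem T_mul_S_mul_S_mul_T_inv :
    ModularGroup.T * ModularGroup.S * ModularGroup.S * ModularGroup.T⁻¹ = -1 := by
  rw [mul_assoc ModularGroup.T, S_mul_S, mul_neg_one, neg_mul, mul_inv_cancel]

/-- The `C`-edge of `P_k` is the `C*`-edge of `M_{k+1}`: `(hTS·S)·(T⁻¹·ζ) = h·ζ`. [folklore] -/
theorem mul_TS_mul_S_smul_T_inv_smul (h : SL(2, ℤ)) (ζ : ℍ) :
    (h * (ModularGroup.T * ModularGroup.S) * ModularGroup.S) • ModularGroup.T⁻¹ • ζ = h • ζ := by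
  rw [← mul_smul, mul_assoc h, mul_assoc h, T_mul_S_mul_S_mul_T_inv, mul_neg_one,
    ModularGroup.SL_neg_smul]

/-- The `C`-edge of `P₂` is the `C*`-edge of `M₀`: `(g(TS)²)·ζ = (gS)·(T⁻¹·ζ)`. [folklore] -/
theorem mul_TS_mul_TS_smul (g : SL(2, ℤ)) (ζ : ℍ) :
    (g * (ModularGroup.T * ModularGroup.S) * (ModularGroup.T * ModularGroup.S)) • ζ =
      (g * ModularGroup.S) • ModularGroup.T⁻¹ • ζ := by
  rw [mul_assoc g, TS_mul_TS, ← mul_smul, mul_assoc g]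

/-! ### The reduction -/

/-- **Manin's three-term relation in the KZ calculus, reduced to the six per-tile Cauchy relations**
(part-generic form: `ℓ = re` or `im`, or any function `ℂ → ℝ`). Data: a weight-two cusp form `f`,
`g ∈ SL₂(ℤ)`, edge parametrisations `ζB, ζC : ℝ → ℍ` (by `u = j`) of the interior edges `B`, `C` of the
tile `τ₀`; six `A`-edge representations `A₀, A₀', A₁, A₁', A₂, A₂'` over `arcDomain = (1728,∞)` with
integrands `ℓ ∘ arcIntegrand (f ∣ h)` for `h = g, gS, gR, gRS, gR², gR²S` (`R = TS`). Hypotheses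
`hP₀, hP₁, hP₂` (tiles `gR^k τ₀`) and `hM₀, hM₁, hM₂` (tiles `gR^kS τ₀*`, edge parametrisations
`S ∘ ζB`, `T⁻¹ ∘ ζC`): there are edge representations over `(1728,∞)`, `(0,1728)`, `(−∞,0)` with the
tile's integrands `ℓ((ω/dj)(f ∣ h)(ζ(u)))` whose formal sum is a relation (Cauchy for the tile, written
in the calculus). Conclusion: `([A₀] − [A₀']) + ([A₁] − [A₁']) + ([A₂] − [A₂']) ∈ KZ.relations`.
Proof: `six_tile_combination`; the interior edges cancel because paired edges carry equal integrands
(`djQuot_SL_slash` and `S² = −1`, `TS·S·T⁻¹ = −1`, `(TS)² = ST⁻¹` — `TS_mul_TS` of the value file), and each `Aₖ` is equivalent to the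
tile's own `A`-edge representation (same domain, same integrand). [cite: Manin1972, §1.6] -/
theorem three_term_of_tiles (ℓ : ℂ → ℝ) (f : CuspForm (Gamma0 N) 2) (g : SL(2, ℤ)) (ζB ζC : ℝ → ℍ)
    (A₀ A₀' A₁ A₁' A₂ A₂' : IntegralRep 1)
    (hA₀ : A₀.domain = arcDomain)
    (hA₀i : EqOn A₀.integrand (fun x => ℓ (arcIntegrand (⇑f ∣[(2 : ℤ)] g) (x 0))) arcDomain)
    (hA₀' : A₀'.domain = arcDomain)
    (hA₀'i : EqOn A₀'.integrand
      (fun x => ℓ (arcIntegrand (⇑f ∣[(2 : ℤ)] (g * ModularGroup.S)) (x 0))) arcDomain)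
    (hA₁ : A₁.domain = arcDomain)
    (hA₁i : EqOn A₁.integrand
      (fun x => ℓ (arcIntegrand (⇑f ∣[(2 : ℤ)] (g * (ModularGroup.T * ModularGroup.S))) (x 0)))
      arcDomain)
    (hA₁' : A₁'.domain = arcDomain)
    (hA₁'i : EqOn A₁'.integrand
      (fun x => ℓ (arcIntegrand
        (⇑f ∣[(2 : ℤ)] (g * (ModularGroup.T * ModularGroup.S) * ModularGroup.S)) (x 0))) arcDomain)
    (hA₂ : A₂.domain = arcDomain)
    (hA₂i : EqOn A₂.integrand
      (fun x => ℓ (arcIntegrand (⇑f ∣[(2 : ℤ)]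
        (g * (ModularGroup.T * ModularGroup.S) * (ModularGroup.T * ModularGroup.S))) (x 0)))
      arcDomain)
    (hA₂' : A₂'.domain = arcDomain)
    (hA₂'i : EqOn A₂'.integrand
      (fun x => ℓ (arcIntegrand (⇑f ∣[(2 : ℤ)] (g * (ModularGroup.T * ModularGroup.S) *
        (ModularGroup.T * ModularGroup.S) * ModularGroup.S)) (x 0))) arcDomain)
    (hP₀ : ∃ a b c : IntegralRep 1,
      a.domain = arcDomain ∧
      EqOn a.integrand (fun x => ℓ (arcIntegrand (⇑f ∣[(2 : ℤ)] g) (x 0))) arcDomain ∧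
      b.domain = {x | x 0 ∈ Ioo (0 : ℝ) 1728} ∧
      EqOn b.integrand (fun x => ℓ (djQuot (⇑f ∣[(2 : ℤ)] g) (ζB (x 0))))
        {x | x 0 ∈ Ioo (0 : ℝ) 1728} ∧
      c.domain = {x | x 0 < 0} ∧
      EqOn c.integrand (fun x => ℓ (djQuot (⇑f ∣[(2 : ℤ)] g) (ζC (x 0)))) {x | x 0 < 0} ∧
      KZ.of a + KZ.of b + KZ.of c ∈ KZ.relations)
    (hP₁ : ∃ a b c : IntegralRep 1,
      a.domain = arcDomain ∧
      EqOn a.integrand (fun x => ℓ (arcIntegrand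
        (⇑f ∣[(2 : ℤ)] (g * (ModularGroup.T * ModularGroup.S))) (x 0))) arcDomain ∧
      b.domain = {x | x 0 ∈ Ioo (0 : ℝ) 1728} ∧
      EqOn b.integrand (fun x => ℓ (djQuot
        (⇑f ∣[(2 : ℤ)] (g * (ModularGroup.T * ModularGroup.S))) (ζB (x 0))))
        {x | x 0 ∈ Ioo (0 : ℝ) 1728} ∧
      c.domain = {x | x 0 < 0} ∧
      EqOn c.integrand (fun x => ℓ (djQuot
        (⇑f ∣[(2 : ℤ)] (g * (ModularGroup.T * ModularGroup.S))) (ζC (x 0)))) {x | x 0 < 0} ∧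
      KZ.of a + KZ.of b + KZ.of c ∈ KZ.relations)
    (hP₂ : ∃ a b c : IntegralRep 1,
      a.domain = arcDomain ∧
      EqOn a.integrand (fun x => ℓ (arcIntegrand (⇑f ∣[(2 : ℤ)]
        (g * (ModularGroup.T * ModularGroup.S) * (ModularGroup.T * ModularGroup.S))) (x 0)))
        arcDomain ∧
      b.domain = {x | x 0 ∈ Ioo (0 : ℝ) 1728} ∧
      EqOn b.integrand (fun x => ℓ (djQuot (⇑f ∣[(2 : ℤ)]
        (g * (ModularGroup.T * ModularGroup.S) * (ModularGroup.T * ModularGroup.S))) (ζB (x 0))))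
        {x | x 0 ∈ Ioo (0 : ℝ) 1728} ∧
      c.domain = {x | x 0 < 0} ∧
      EqOn c.integrand (fun x => ℓ (djQuot (⇑f ∣[(2 : ℤ)]
        (g * (ModularGroup.T * ModularGroup.S) * (ModularGroup.T * ModularGroup.S))) (ζC (x 0))))
        {x | x 0 < 0} ∧
      KZ.of a + KZ.of b + KZ.of c ∈ KZ.relations)
    (hM₀ : ∃ a b c : IntegralRep 1,
      a.domain = arcDomain ∧
      EqOn a.integrand (fun x => ℓ (arcIntegrand (⇑f ∣[(2 : ℤ)] (g * ModularGroup.S)) (x 0)))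
        arcDomain ∧
      b.domain = {x | x 0 ∈ Ioo (0 : ℝ) 1728} ∧
      EqOn b.integrand (fun x => ℓ (djQuot (⇑f ∣[(2 : ℤ)] (g * ModularGroup.S))
        (ModularGroup.S • ζB (x 0)))) {x | x 0 ∈ Ioo (0 : ℝ) 1728} ∧
      c.domain = {x | x 0 < 0} ∧
      EqOn c.integrand (fun x => ℓ (djQuot (⇑f ∣[(2 : ℤ)] (g * ModularGroup.S))
        (ModularGroup.T⁻¹ • ζC (x 0)))) {x | x 0 < 0} ∧
      KZ.of a + KZ.of b + KZ.of c ∈ KZ.relations)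
    (hM₁ : ∃ a b c : IntegralRep 1,
      a.domain = arcDomain ∧
      EqOn a.integrand (fun x => ℓ (arcIntegrand
        (⇑f ∣[(2 : ℤ)] (g * (ModularGroup.T * ModularGroup.S) * ModularGroup.S)) (x 0)))
        arcDomain ∧
      b.domain = {x | x 0 ∈ Ioo (0 : ℝ) 1728} ∧
      EqOn b.integrand (fun x => ℓ (djQuot
        (⇑f ∣[(2 : ℤ)] (g * (ModularGroup.T * ModularGroup.S) * ModularGroup.S))
        (ModularGroup.S • ζB (x 0)))) {x | x 0 ∈ Ioo (0 : ℝ) 1728} ∧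
      c.domain = {x | x 0 < 0} ∧
      EqOn c.integrand (fun x => ℓ (djQuot
        (⇑f ∣[(2 : ℤ)] (g * (ModularGroup.T * ModularGroup.S) * ModularGroup.S))
        (ModularGroup.T⁻¹ • ζC (x 0)))) {x | x 0 < 0} ∧
      KZ.of a + KZ.of b + KZ.of c ∈ KZ.relations)
    (hM₂ : ∃ a b c : IntegralRep 1,
      a.domain = arcDomain ∧
      EqOn a.integrand (fun x => ℓ (arcIntegrand (⇑f ∣[(2 : ℤ)]
        (g * (ModularGroup.T * ModularGroup.S) * (ModularGroup.T * ModularGroup.S) *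
          ModularGroup.S)) (x 0))) arcDomain ∧
      b.domain = {x | x 0 ∈ Ioo (0 : ℝ) 1728} ∧
      EqOn b.integrand (fun x => ℓ (djQuot (⇑f ∣[(2 : ℤ)]
        (g * (ModularGroup.T * ModularGroup.S) * (ModularGroup.T * ModularGroup.S) *
          ModularGroup.S)) (ModularGroup.S • ζB (x 0)))) {x | x 0 ∈ Ioo (0 : ℝ) 1728} ∧
      c.domain = {x | x 0 < 0} ∧
      EqOn c.integrand (fun x => ℓ (djQuot (⇑f ∣[(2 : ℤ)]
        (g * (ModularGroup.T * ModularGroup.S) * (ModularGroup.T * ModularGroup.S) *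
          ModularGroup.S)) (ModularGroup.T⁻¹ • ζC (x 0)))) {x | x 0 < 0} ∧
      KZ.of a + KZ.of b + KZ.of c ∈ KZ.relations) :
    (KZ.of A₀ - KZ.of A₀') + (KZ.of A₁ - KZ.of A₁') + (KZ.of A₂ - KZ.of A₂') ∈ KZ.relations := by
  obtain ⟨a₀, b₀, c₀, ha₀, ha₀i, hb₀, hb₀i, hc₀, hc₀i, h₀⟩ := hP₀
  obtain ⟨a₁, b₁, c₁, ha₁, ha₁i, hb₁, hb₁i, hc₁, hc₁i, h₁⟩ := hP₁
  obtain ⟨a₂, b₂, c₂, ha₂, ha₂i, hb₂, hb₂i, hc₂, hc₂i, h₂⟩ := hP₂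
  obtain ⟨a₀', b₀', c₀', ha₀', ha₀'i, hb₀', hb₀'i, hc₀', hc₀'i, h₀'⟩ := hM₀
  obtain ⟨a₁', b₁', c₁', ha₁', ha₁'i, hb₁', hb₁'i, hc₁', hc₁'i, h₁'⟩ := hM₁
  obtain ⟨a₂', b₂', c₂', ha₂', ha₂'i, hb₂', hb₂'i, hc₂', hc₂'i, h₂'⟩ := hM₂
  -- replace each tile's own `A`-edge representation by the given one (same domain, same integrand)
  have swapA : ∀ {A a b c : IntegralRep 1} {F : (Fin 1 → ℝ) → ℝ}, A.domain = arcDomain →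
      EqOn A.integrand F arcDomain → a.domain = arcDomain → EqOn a.integrand F arcDomain →
      KZ.of a + KZ.of b + KZ.of c ∈ KZ.relations → KZ.of A + KZ.of b + KZ.of c ∈ KZ.relations := by
    intro A a b c F hA hAi ha hai h
    have e : KZ.of A - KZ.of a ∈ KZ.relations :=
      of_sub_of_mem_relations_of_eqOn_eqOn hA hAi ha hai fun _ _ => rfl
    have := KZ.relations.add_mem e h
    convert this using 1
    abel
  refine six_tile_combination KZ.relations
    (swapA hA₀ hA₀i ha₀ ha₀i h₀) (swapA hA₁ hA₁i ha₁ ha₁i h₁) (swapA hA₂ hA₂i ha₂ ha₂i h₂)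
    (swapA hA₀' hA₀'i ha₀' ha₀'i h₀') (swapA hA₁' hA₁'i ha₁' ha₁'i h₁')
    (swapA hA₂' hA₂'i ha₂' ha₂'i h₂') ?_ ?_ ?_ ?_ ?_ ?_
  -- `B`-edges: `P_k` versus `M_k`
  · exact of_sub_of_mem_relations_of_eqOn_eqOn hb₀ hb₀i hb₀' hb₀'i fun x _ => by
      simp only [djQuot_SL_slash, mul_S_smul_S_smul]
  · exact of_sub_of_mem_relations_of_eqOn_eqOn hb₁ hb₁i hb₁' hb₁'i fun x _ => by
      simp only [djQuot_SL_slash, mul_S_smul_S_smul]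
  · exact of_sub_of_mem_relations_of_eqOn_eqOn hb₂ hb₂i hb₂' hb₂'i fun x _ => by
      simp only [djQuot_SL_slash, mul_S_smul_S_smul]
  -- `C`-edges: `P_k` versus `M_{k+1}`
  · exact of_sub_of_mem_relations_of_eqOn_eqOn hc₀ hc₀i hc₁' hc₁'i fun x _ => by
      simp only [djQuot_SL_slash, mul_TS_mul_S_smul_T_inv_smul]
  · exact of_sub_of_mem_relations_of_eqOn_eqOn hc₁ hc₁i hc₂' hc₂'i fun x _ => by
      simp only [djQuot_SL_slash, mul_TS_mul_S_smul_T_inv_smul]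
  · exact of_sub_of_mem_relations_of_eqOn_eqOn hc₂ hc₂i hc₀' hc₀'i fun x _ => by
      simp only [djQuot_SL_slash, mul_TS_mul_TS_smul]

end Summit.KontsevichZagierPeriods.HeckeMultiplicityOne.ManinStokes
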